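import Literature.NumberTheory.CubicFields.DeloneFaddeevCorrespondence
import Literature.NumberTheory.CubicFields.DeloneFaddeevIrreducible
import Mathlib.NumberTheory.NumberField.Discriminant.Defs
import HarnessLib

/-!
# Cubic number fields ↦ `GL₂(ℤ)`-orbits of irreducible integral binary cubic forms

Topic `Literature/NumberTheory/CubicFields`; the bridge from the Levi–Delone–Faddeev files
(`DeloneFaddeevCorrespondence.lean`: cubic rings ↔ `GL₂(ℤ)`-orbits on `V(ℤ)`,
discriminant-preserving; `DeloneFaddeevIrreducible.lean`: integral domains ↔ irreducible forms)
to Mathlib's number fields.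

Bhargava–Taniguchi–Thorne 2023, §2.1–2.2: "Cubic fields are in bijection with their maximal
orders … The discriminant of a cubic étale algebra `F` is, by definition, equal to the
discriminant of its maximal order `𝓞_F`", and Thm 2.1 (Levi–Delone–Faddeev). Consequently the
Davenport–Heilbronn count of cubic fields `N₃(X)` is a count of certain `GL₂(ℤ)`-orbits of
irreducible integral binary cubic forms `f` with `0 < |Disc(f)| < X` (BTT §2.2, the paragraph after
Prop. 2.2). This file proves the map and its properties:

* `finrank_ringOfIntegers_eq_three` — the maximal order `𝓞 K` of a cubic number field is a cubic
  ring (free of rank `3` over `ℤ`);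
* `exists_ringOfForm_ringEquiv_ringOfIntegers` — **`𝓞 K ≅ R(f)` for some integral binary cubic
  form `f`**, unique up to `GL₂(ℤ)` (`gl2zEquiv_of_ringEquiv_ringOfIntegers`);
* `isIrreducible_of_ringEquiv_ringOfIntegers` — any such `f` is irreducible over `ℚ`;
* `disc_eq_discr_of_ringEquiv_ringOfIntegers` — **`Disc(f) = Disc(K)`** (Mathlib's
  `NumberField.discr K`);
* `gl2zEquiv_of_ringEquiv_ringOfIntegers_of_ringEquiv` — isomorphic cubic fields give
  `GL₂(ℤ)`-equivalent forms: the map {cubic fields}/≅ → `GL₂(ℤ)\V(ℤ)` is well defined, and it is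
  injective (`nonempty_ringEquiv_of_gl2zEquiv_forms`: equivalent forms give isomorphic maximal
  orders, hence isomorphic fields of fractions).

NOT here: the image (maximal irreducible forms, BTT Prop. 2.2 / Davenport–Heilbronn), and the
finiteness/count `N₃(X)`.

## References

* M. Bhargava, T. Taniguchi, F. Thorne, *Improved error estimates for the Davenport–Heilbronn
  theorems*, Math. Ann. 389 (2024) = arXiv:2107.12819, §2.1–2.2, Thm 2.1 [BhargavaTaniguchiThorne2023].
* H. Davenport, H. Heilbronn, *On the density of discriminants of cubic fields. II*, Proc. Roy.
  Soc. London A 322 (1971) [DavenportHeilbronn1971].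
-/

namespace Literature.NumberTheory.CubicFields

open NumberField Module BinaryCubic

section CubicField

variable (K : Type*) [Field K] [NumberField K]

/-- **The maximal order of a cubic number field is a cubic ring**: `𝓞 K` is free of rank `3` over
`ℤ` when `[K : ℚ] = 3` (BTT 2023, §2.1). [cite: BhargavaTaniguchiThorne2023, §2.1 (cubic fields and their maximal orders)] -/
theorem finrank_ringOfIntegers_eq_three (h3 : Module.finrank ℚ K = 3) : Module.finrank ℤ (𝓞 K) = 3 := by
  rw [RingOfIntegers.rank, h3]

/-- **Every cubic number field comes from a binary cubic form**: `𝓞 K ≅ R(f)` for some integral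
binary cubic form `f` (Levi–Delone–Faddeev surjectivity applied to the cubic ring `𝓞 K`;
BTT 2023, Thm 2.1 with §2.1). [cite: BhargavaTaniguchiThorne2023, Theorem 2.1 (cubic fields ↦ GL₂(ℤ)-orbits via maximal orders)] -/
theorem exists_ringOfForm_ringEquiv_ringOfIntegers (h3 : Module.finrank ℚ K = 3) :
    ∃ f : BinaryCubic ℤ, Nonempty (RingOfForm f ≃+* 𝓞 K) :=
  RingOfForm.exists_ringEquiv_of_finrank_eq_three (finrank_ringOfIntegers_eq_three K h3)

variable {K}

omit [NumberField K] in
/-- The form of a cubic field is unique up to `GL₂(ℤ)`. [folklore] -/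
theorem gl2zEquiv_of_ringEquiv_ringOfIntegers {f g : BinaryCubic ℤ} (e : RingOfForm f ≃+* 𝓞 K)
    (e' : RingOfForm g ≃+* 𝓞 K) : GL2ZEquiv f g :=
  GL2ZEquiv.of_ringEquiv (e.trans e'.symm)

omit [NumberField K] in
/-- **The form of a cubic field is irreducible over `ℚ`** (`𝓞 K` is an integral domain; BTT
Thm 2.1, clause 2). [cite: BhargavaTaniguchiThorne2023, Theorem 2.1 (irreducible forms ↔ orders in cubic fields)] -/
theorem isIrreducible_of_ringEquiv_ringOfIntegers {f : BinaryCubic ℤ} (e : RingOfForm f ≃+* 𝓞 K) :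
    f.IsIrreducible := by
  haveI : IsDomain (RingOfForm f) := MulEquiv.isDomain (𝓞 K) e.toMulEquiv
  exact RingOfForm.isIrreducible_of_isDomain f

/-- **`Disc(f) = Disc(K)`**: the discriminant of the form of a cubic field is the (absolute)
discriminant of the field — Mathlib's `NumberField.discr K = Disc(𝓞 K)`, and the Levi–Delone–Faddeev
map is discriminant-preserving (BTT 2023, §2.1 and Thm 2.1). [cite: BhargavaTaniguchiThorne2023, §2.1 (discriminant of a cubic field = discriminant of its maximal order)] -/
theorem disc_eq_discr_of_ringEquiv_ringOfIntegers (h3 : Module.finrank ℚ K = 3) {f : BinaryCubic ℤ}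
    (e : RingOfForm f ≃+* 𝓞 K) : f.disc = NumberField.discr K := by
  classical
  obtain ⟨b, hb⟩ := RingOfForm.exists_basis_apply_zero_eq_one (S := 𝓞 K)
    (finrank_ringOfIntegers_eq_three K h3)
  rw [← NumberField.discr_eq_discr K b, discr_eq_disc_of_ringEquiv b hb e]

/-- In particular the form of a cubic field is nondegenerate: `Disc(f) ≠ 0`. [folklore] -/
theorem disc_ne_zero_of_ringEquiv_ringOfIntegers (h3 : Module.finrank ℚ K = 3) {f : BinaryCubic ℤ}
    (e : RingOfForm f ≃+* 𝓞 K) : f.disc ≠ 0 := by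
  rw [disc_eq_discr_of_ringEquiv_ringOfIntegers h3 e]
  exact NumberField.discr_ne_zero K

/-- **Isomorphic cubic fields have `GL₂(ℤ)`-equivalent forms** (the map
{cubic fields}/≅ → `GL₂(ℤ)\V(ℤ)` is well defined): a field isomorphism restricts to the maximal
orders. [folklore] -/
theorem gl2zEquiv_of_ringEquiv_ringOfIntegers_of_ringEquiv {L : Type*} [Field L] [NumberField L]
    {f g : BinaryCubic ℤ} (e : RingOfForm f ≃+* 𝓞 K) (e' : RingOfForm g ≃+* 𝓞 L) (φ : K ≃+* L) :
    GL2ZEquiv f g := by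
  let φ₀ : K ≃ₐ[ℚ] L := AlgEquiv.ofRingEquiv (f := φ) fun _ => by simp
  let ψ : 𝓞 K ≃+* 𝓞 L := ((φ₀.restrictScalars ℤ).mapIntegralClosure).toRingEquiv
  exact GL2ZEquiv.of_ringEquiv ((e.trans ψ).trans e'.symm)

/-- **Injectivity**: cubic fields whose forms are `GL₂(ℤ)`-equivalent have isomorphic maximal
orders (Levi–Delone–Faddeev), hence are isomorphic (as the fields of fractions of their maximal
orders). [folklore] -/
theorem nonempty_ringEquiv_of_gl2zEquiv_forms {L : Type*} [Field L] [NumberField L]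
    {f g : BinaryCubic ℤ} (e : RingOfForm f ≃+* 𝓞 K) (e' : RingOfForm g ≃+* 𝓞 L) (h : GL2ZEquiv f g) :
    Nonempty (K ≃+* L) := by
  obtain ⟨ε⟩ := RingOfForm.nonempty_ringEquiv_of_gl2zEquiv h
  -- `𝓞 K ≅ R(f) ≅ R(g) ≅ 𝓞 L`, and `K = Frac 𝓞 K`, `L = Frac 𝓞 L`
  let ψ : 𝓞 K ≃+* 𝓞 L := (e.symm.trans ε.symm).trans e'
  exact ⟨IsFractionRing.ringEquivOfRingEquiv (A := 𝓞 K) (K := K) (B := 𝓞 L) (L := L) ψ⟩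

end CubicField

end Literature.NumberTheory.CubicFields
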